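import Summits.QuantumFields.YangMills.Theorems.FluctuationComparisonRegPrIntLS2BetaTopLadderStage
import HarnessLib

/-!
# S2β · Q11e — THE `η = Ad_{δ_U⁻¹}(R)·ε` FACTORISATION OF THE STAGE CHORD AND THE ε-FACTOR'S LADDER BOUND AT EVERY LEVEL
# (any torus in standing range, any `GaugeGroup`, any averaging family; px21 g24's §102.9 architecture, ε-side)

Cell `ym3-torus` (rung R3 = continuum `SU(2)` YM₃ on T³ at fixed lattice data — NOT d = 4, NOT infinite volume, NOT a mass gap, NOT Clay).  Width seat `ym3-torus-px5` (gen 23);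
crux `stmt-QuantumFields-20520`, LINE g18-1 S2β; LIFT-LADDER″ rows (px10 ✓p831454 FILE 3″: COMB-ROW′, NC-ROW′, (SCT′₁₂₃)).  px21 g24 19:19:31Z (UV3-NODE §102.9): with the two towers'
stage fields `W_t := g j • iter j U`, `U_t := g₀ j • iter j U₁`, their LIFTS `A_W := lift j (g (j+1) • iter (j+1) U)`, `A_U := lift j (g₀ (j+1) • iter (j+1) U₁)`, the relative lift
`R := A_U⁻¹·A_W`, `δ_U := A_U⁻¹·U_t`, `W̃ := A_W·A_U⁻¹·U_t` and `ε := W̃⁻¹·W_t`, one has EXACTLY `η := U_t⁻¹·W_t = δ_U⁻¹·R·δ_U · ε` (§1, `group`), so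
`dist1 η ≤ dist1 R + dist1 ε` (px21 g24 §3 ∕ px12 g26 FILE D type the identity as lemmas; here it is an inline `have`); and since by (T4) ((4b) ✓`stageField_treeComb_eq_lift`, both towers) `W_t = A_W` and `U_t = A_U` on every TREE-COMB bond, `W̃ = W_t` there, whence
Q11b-lattice ✓p831150 `dist1_chord_le_of_intraBlock` prices the ε-factor of every INTRA-BLOCK bond by a pure ladder of the relative plaquettes of `(W_t, W̃)`:
`dist1 ε⟨y,e⟩ ≤ (Σ_{ν<e}|(y − emb B)_ν|)·ρ̃` (§1) — AT EVERY LEVEL, no top-stage hypothesis, for the TWO TOWERS' stage fields under (4b)'s (T4) readings (px21 g24's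
⧗`…RelativeLiftFactorisationEps` states the abstract pair form with agreement hypotheses `hU`, `hW`; THIS FILE is the tower instantiation, `hU`∕`hW` DISCHARGED by (4b)); §2 combines: `dist1 η⟨y,e⟩ ≤ dist1 R⟨y,e⟩ + (Σ_{ν<e}|(y − emb B)_ν|)·ρ̃` (relative LIFT + ladder
SOURCES — the per-bond form of the `M`-row).  The `R`-letters (✓p829341∕✓p829498) and `ρ̃`'s bound (lift curvature) are px12's lineage, NOT here.  `--kind proof --supports
stmt-QuantumFields-20520 --as helper`, count-neutral, DEFINITION-FREE (0 `def`, 0 `instance`, 0 `notation`, 0 `sorry`, default heartbeats; `W̃` is an inline lambda); generic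
`P : Params` (standing range), ANY `GaugeGroup G`, ANY `av : ∀ i, Averaging P i G`, abstract `lift`∕`g`∕`g₀` under (4b)'s (T4) readings.

WHAT IS PROVED (sorry-free).
* §1 `tilde_agree_of_treeComb` (`W_t = W̃` on the tree-comb bonds of a block, from `hT4`, `hT4'`), ★★★`dist1_eps_le_of_intraBlock_stage`.
* §2 ★★★`dist1_eta_le_of_intraBlock_stage` — **`dist1 (U_t⟨y,e⟩⁻¹·W_t⟨y,e⟩) ≤ dist1 (A_U⟨y,e⟩⁻¹·A_W⟨y,e⟩) + (Σ_{ν<e}|(y − emb B)_ν|)·ρ̃`** for `y, y + e ∈ B`.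

HONEST SCOPE.  Group∕lattice bookkeeping over landed lemmas; nothing of Bałaban's analysis is asserted or proved; `R`'s pair∕sup letters, `ρ̃`'s bound, the `Ad_{δ_U}` variation (`T₂₁`), the
pair assembly of the `V`-row, READ′ aggregation are NOT here; COMB-ROW′∕NC-ROW′∕(TOP-LAD′)∕(SCT′₁₂₃)∕(ST′)∕(ST), LOC's discharge, «MULT♭-ax»∕«CRIT-ax», (D-stage), h3, GAP♯∘
(`stub_uniformFibreGapOrbit`, registry 3732b7df UNTOUCHED, 0∕5), S2β, the five registered stubs, 20520, 19936, 19200, `YM3TorusSU2` NOT proved; no summit statement is proved by a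
helper; rung R3 — NOT d = 4, NOT infinite volume, NOT a mass gap, NOT Clay; the Yang–Mills mass gap is NOT proved.

References: T. Bałaban, CMP **102** (1985) 277–309 [Balaban1985RegularSpaces] ((1.19) p.79: `U′ = A·δ` on the comb, (1.29) p.81); CMP **98** (1985) 17–51 [Balaban1985Averaging]
((58) p.27); CMP **122** (1989) 355–392 [Balaban1989LargeFieldII] (p.382).
-/

set_option autoImplicit false

namespace Summit.QuantumFields.YangMills.Theorems.FluctuationComparisonRegPrIntLS2BetaEtaFactorisation

open Literature.MathematicalPhysics.QuantumFieldTheory.Balaban1983to89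
open Literature.MathematicalPhysics.QuantumFieldTheory.Balaban1983to89.T4Continuum
open Literature.MathematicalPhysics.QuantumFieldTheory.Balaban1983to89.BlockAveraging
open B10Eq27TorusAxialLog (rel axialT)
open Summit.QuantumFields.YangMills.Theorems.FluctuationComparisonRegPrIntLS2BetaTreeCombBondStep (stageField_treeComb_eq_lift)
open Summit.QuantumFields.YangMills.Theorems.FluctuationComparisonRegPrIntLS2BetaTopLadderIntraBlock (dist1_chord_le_of_intraBlock)

variable {P : Params} {G : Type*} [GaugeGroup G]

/-! ## §1 The ε-factor of the two towers: `W̃ = W_t` on tree-comb bonds, hence a pure ladder on every intra-block bond -/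

/-- On every tree-comb bond of the block `B` the stage field `W_t = g j • iter j U` coincides with `W̃ := A_W·A_U⁻¹·U_t` — (T4) for both towers ((4b) ✓`stageField_treeComb_eq_lift`).
[cite: Balaban1985RegularSpaces, (1.19) p.79; Balaban1985Averaging, (58) p.27] -/
theorem tilde_agree_of_treeComb (av : ∀ i, Averaging P i G) {j : ℕ} (hj : j + 1 ≤ P.m + P.K)
    (lift : (i : ℕ) → GaugeField P (i + 1) G → GaugeField P i G) (g g₀ : (i : ℕ) → Site P i → G) (U U₁ : GaugeField P 0 G)
    (hT4 : ∀ x, axialT (GaugeField.gaugeAct (g j) (Averaging.iter av j U)) (emb (blockOf x)) x =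
      axialT (lift j (GaugeField.gaugeAct (g (j + 1)) (Averaging.iter av (j + 1) U))) (emb (blockOf x)) x)
    (hT4' : ∀ x, axialT (GaugeField.gaugeAct (g₀ j) (Averaging.iter av j U₁)) (emb (blockOf x)) x =
      axialT (lift j (GaugeField.gaugeAct (g₀ (j + 1)) (Averaging.iter av (j + 1) U₁))) (emb (blockOf x)) x)
    (B : Site P (j + 1)) :
    ∀ (x : Site P j) (μ : Fin P.d), blockOf x = B → blockOf (x.shift μ) = B → (∀ ν, ν < μ → rel (emb B) x ν = 0) →
      GaugeField.gaugeAct (g j) (Averaging.iter av j U) ⟨x, μ⟩ =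
        (fun b => lift j (GaugeField.gaugeAct (g (j + 1)) (Averaging.iter av (j + 1) U)) b *
            (lift j (GaugeField.gaugeAct (g₀ (j + 1)) (Averaging.iter av (j + 1) U₁)) b)⁻¹ *
          GaugeField.gaugeAct (g₀ j) (Averaging.iter av j U₁) b : GaugeField P j G) ⟨x, μ⟩ := by
  intro x μ hx hxμ hlo
  have hblk : blockOf (x.shift μ) = blockOf x := by rw [hxμ, hx]
  have hlo' : ∀ ν, ν < μ → rel (emb (blockOf x)) x ν = 0 := fun ν hν => by rw [hx]; exact hlo ν hν
  have hW := stageField_treeComb_eq_lift av hj lift g U hT4 x μ hblk hlo'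
  have hU := stageField_treeComb_eq_lift av hj lift g₀ U₁ hT4' x μ hblk hlo'
  dsimp only
  rw [hU, inv_mul_cancel_right]
  exact hW

/-- ★★★ **THE ε-FACTOR IS A PURE LADDER ON EVERY INTRA-BLOCK BOND, AT EVERY LEVEL**: if every plaquette with source in the block `B` has `dist1 ((W̃□q)⁻¹·(W_t□q)) ≤ ρ̃`, then for
`y, y + e ∈ B`: `dist1 (W̃⟨y,e⟩⁻¹·W_t⟨y,e⟩) ≤ (Σ_{ν<e} |(y − emb B)_ν|)·ρ̃`. [cite: Balaban1989LargeFieldII, p.382; Balaban1985RegularSpaces, (1.19) p.79] -/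
theorem dist1_eps_le_of_intraBlock_stage (av : ∀ i, Averaging P i G) {j : ℕ} (hj : j + 1 ≤ P.m + P.K)
    (lift : (i : ℕ) → GaugeField P (i + 1) G → GaugeField P i G) (g g₀ : (i : ℕ) → Site P i → G) (U U₁ : GaugeField P 0 G)
    (hT4 : ∀ x, axialT (GaugeField.gaugeAct (g j) (Averaging.iter av j U)) (emb (blockOf x)) x =
      axialT (lift j (GaugeField.gaugeAct (g (j + 1)) (Averaging.iter av (j + 1) U))) (emb (blockOf x)) x)
    (hT4' : ∀ x, axialT (GaugeField.gaugeAct (g₀ j) (Averaging.iter av j U₁)) (emb (blockOf x)) x =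
      axialT (lift j (GaugeField.gaugeAct (g₀ (j + 1)) (Averaging.iter av (j + 1) U₁))) (emb (blockOf x)) x)
    (B : Site P (j + 1)) {ρt : ℝ} (hρ0 : 0 ≤ ρt)
    (hρ : ∀ q : Plaq P j, blockOf q.src = B →
      dist1 ((GaugeField.plaqHol (fun b => lift j (GaugeField.gaugeAct (g (j + 1)) (Averaging.iter av (j + 1) U)) b *
            (lift j (GaugeField.gaugeAct (g₀ (j + 1)) (Averaging.iter av (j + 1) U₁)) b)⁻¹ *
          GaugeField.gaugeAct (g₀ j) (Averaging.iter av j U₁) b : GaugeField P j G) q)⁻¹ *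
        GaugeField.plaqHol (GaugeField.gaugeAct (g j) (Averaging.iter av j U)) q) ≤ ρt)
    (y : Site P j) (e' : Fin P.d) (hy : blockOf y = B) (hye : blockOf (y.shift e') = B) :
    dist1 (((fun b => lift j (GaugeField.gaugeAct (g (j + 1)) (Averaging.iter av (j + 1) U)) b *
            (lift j (GaugeField.gaugeAct (g₀ (j + 1)) (Averaging.iter av (j + 1) U₁)) b)⁻¹ *
          GaugeField.gaugeAct (g₀ j) (Averaging.iter av j U₁) b : GaugeField P j G) ⟨y, e'⟩)⁻¹ *
        GaugeField.gaugeAct (g j) (Averaging.iter av j U) ⟨y, e'⟩) ≤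
      (∑ ν ∈ Finset.univ.filter (fun ν => ν < e'), (rel (emb B) y ν).natAbs) * ρt :=
  dist1_chord_le_of_intraBlock hj _ _ B (tilde_agree_of_treeComb av hj lift g g₀ U U₁ hT4 hT4' B) hρ0 hρ y e' hy hye

/-! ## §2 `dist1 η ≤ dist1 R + ladder` on every intra-block bond of the two towers -/

/-- ★★★ **THE STAGE CHORD ON AN INTRA-BLOCK BOND: RELATIVE LIFT + LADDER SOURCES** (every level, both towers under (T4)):
`dist1 (U_t⟨y,e⟩⁻¹·W_t⟨y,e⟩) ≤ dist1 (A_U⟨y,e⟩⁻¹·A_W⟨y,e⟩) + (Σ_{ν<e} |(y − emb B)_ν|)·ρ̃` for `y, y + e ∈ B`. [cite: Balaban1985RegularSpaces, (1.19) p.79, (1.29) p.81; Balaban1989LargeFieldII, p.382] -/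
theorem dist1_eta_le_of_intraBlock_stage (av : ∀ i, Averaging P i G) {j : ℕ} (hj : j + 1 ≤ P.m + P.K)
    (lift : (i : ℕ) → GaugeField P (i + 1) G → GaugeField P i G) (g g₀ : (i : ℕ) → Site P i → G) (U U₁ : GaugeField P 0 G)
    (hT4 : ∀ x, axialT (GaugeField.gaugeAct (g j) (Averaging.iter av j U)) (emb (blockOf x)) x =
      axialT (lift j (GaugeField.gaugeAct (g (j + 1)) (Averaging.iter av (j + 1) U))) (emb (blockOf x)) x)
    (hT4' : ∀ x, axialT (GaugeField.gaugeAct (g₀ j) (Averaging.iter av j U₁)) (emb (blockOf x)) x =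
      axialT (lift j (GaugeField.gaugeAct (g₀ (j + 1)) (Averaging.iter av (j + 1) U₁))) (emb (blockOf x)) x)
    (B : Site P (j + 1)) {ρt : ℝ} (hρ0 : 0 ≤ ρt)
    (hρ : ∀ q : Plaq P j, blockOf q.src = B →
      dist1 ((GaugeField.plaqHol (fun b => lift j (GaugeField.gaugeAct (g (j + 1)) (Averaging.iter av (j + 1) U)) b *
            (lift j (GaugeField.gaugeAct (g₀ (j + 1)) (Averaging.iter av (j + 1) U₁)) b)⁻¹ *
          GaugeField.gaugeAct (g₀ j) (Averaging.iter av j U₁) b : GaugeField P j G) q)⁻¹ *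
        GaugeField.plaqHol (GaugeField.gaugeAct (g j) (Averaging.iter av j U)) q) ≤ ρt)
    (y : Site P j) (e' : Fin P.d) (hy : blockOf y = B) (hye : blockOf (y.shift e') = B) :
    dist1 ((GaugeField.gaugeAct (g₀ j) (Averaging.iter av j U₁) ⟨y, e'⟩)⁻¹ * GaugeField.gaugeAct (g j) (Averaging.iter av j U) ⟨y, e'⟩) ≤
      dist1 ((lift j (GaugeField.gaugeAct (g₀ (j + 1)) (Averaging.iter av (j + 1) U₁)) ⟨y, e'⟩)⁻¹ *
          lift j (GaugeField.gaugeAct (g (j + 1)) (Averaging.iter av (j + 1) U)) ⟨y, e'⟩) +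
        (∑ ν ∈ Finset.univ.filter (fun ν => ν < e'), (rel (emb B) y ν).natAbs) * ρt := by
  -- the factorisation `u⁻¹·w = (aU⁻¹u)⁻¹·(aU⁻¹aW)·(aU⁻¹u) · ((aW·aU⁻¹·u)⁻¹·w)` (px21 g24 §3 ∕ px12 g26 FILE D state it as a lemma; inline here) and its `dist1` reading
  have h1 : ∀ aU aW u w : G, dist1 (u⁻¹ * w) ≤ dist1 (aU⁻¹ * aW) + dist1 ((aW * aU⁻¹ * u)⁻¹ * w) := by
    intro aU aW u w
    have hf : u⁻¹ * w = ((aU⁻¹ * u)⁻¹ * (aU⁻¹ * aW) * (aU⁻¹ * u)⁻¹⁻¹) * ((aW * aU⁻¹ * u)⁻¹ * w) := by group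
    rw [hf]
    refine (GaugeGroup.dist1_mul_le _ _).trans ?_
    rw [GaugeGroup.dist1_conj]
  have h2 := dist1_eps_le_of_intraBlock_stage av hj lift g g₀ U U₁ hT4 hT4' B hρ0 hρ y e' hy hye
  exact (h1 _ _ _ _).trans (add_le_add le_rfl h2)

end Summit.QuantumFields.YangMills.Theorems.FluctuationComparisonRegPrIntLS2BetaEtaFactorisation
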